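import Mathlib
import Summits.Ventures.HodgeRepro2.T6N5Family

/-!
# T6N5Datum — the N5 DATUM TYPE for the M2 composition carrier (TARGET-T6 v0.4 §9.2(b) field d5,
§9.6 order of work (1)), carrier-free

Tier 6 (README §10), sub-step N5 of the M2 discharge (t6-p7 with t6-p8).  The M2 word (STATUS l. 4691;
TARGET-T6 §9) asks every owner for ONE datum type, definition lane, no display, to become a field of
the lead's composition carrier `NAut`.  For N5 the datum of record (TIER5 (N0.3), (D3)/(D6), §N5.1) is:
the twist family Ξ_𝔭 acting on the four line characters, the side data of the two tori at every twist,
the four Proposition-G branches (route-3 §G, one per line character) whose central values ARE the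
sides' `Lval`, and the datum's chosen twist ν ∈ Ξ_𝔭 (the «one admissible choice of the finite parts»
of [G-N5.1] — §9.5 class EX where print does not give it; here `exists_good_twist` gives it in kernel
from Proposition G).

`Datum.D ν` DEFINES the member ν of the family by overriding the sides' central values with the
branches' L-values, so the side ↔ branch dictionary is `rfl` (no compat Prop field, R6);
`Datum.current` is the datum at its own twist; `Datum.N5` is N5 for the datum.  The theorems are the
fixed-datum form of TIER5 §N5.1 (`N5_of_condC`: Theorem 5.4's shape on both sides, N5.L1 on both sides,
(a), (b) and (c) at ν ⇒ N5), the finite exceptional set of Proposition G (`condC_of_notMem`), the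
existence of a good twist (`exists_good_twist`), and the family form (`exists_N5`).

No display lives here (no `[cite:` docstring).  §8(d): uses an L-value-free non-vanishing device: NO.
-/

namespace Summit.Ventures.HodgeRepro2.T6.N5Datum

open Summit.Ventures.HodgeRepro2.T6.N5Skeleton Summit.Ventures.HodgeRepro2.T6.N5PropG
  Summit.Ventures.HodgeRepro2.T6.N5Family Summit.Ventures.HodgeRepro2.T6.N5Signs

/-- THE N5 DATUM `N5Datum.Datum` (field d5 of the lead's `NAut`): the twist family of side data `base : Ξ → N5Data`
(TIER5 (D3)/(D6): the common twist ν̃ ∈ Ξ_𝔭 acting on the datum), the four Proposition-G branches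
`lineA` (lines 111, 100) and `lineB` (lines 101, 110) over the same family, and the datum's chosen
twist `ν`.  `ι` = the places of F, `G` = the characters of [E¹], `ι'` = the places of the CM field E
(the v | ℭ⁻ of Hsieh's theorem), `K` = the coefficient field of the p-adic measures. -/
structure Datum (ι G Ξ ι' K : Type*) [CommGroup G] [Field K] where
  /-- the side data at every twist (their `Lval` fields are overridden by the branches' L-values). -/
  base : Ξ → N5Data ι G
  /-- the Proposition-G branches of the side-A lines (111, 100). -/
  lineA : Fin 2 → GBranch ι' Ξ K
  /-- the Proposition-G branches of the side-B lines (101, 110). -/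
  lineB : Fin 2 → GBranch ι' Ξ K
  /-- the datum's chosen twist ν ∈ Ξ_𝔭 ((N0.3); [G-N5.1]'s «one admissible choice»). -/
  ν : Ξ

namespace Datum

variable {ι G Ξ ι' K : Type*} [CommGroup G] [Field K] (N : Datum ι G Ξ ι' K)

/-- The member ν of the twist family: the base side data at ν with the central values of the lines
taken from the branches (`Lval i := (line i).L ν`). -/
def D (ν : Ξ) : N5Data ι G where
  A := { (N.base ν).A with Lval := fun i => (N.lineA i).L ν }
  B := { (N.base ν).B with Lval := fun i => (N.lineB i).L ν }
  same_β := (N.base ν).same_β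
  same_f := (N.base ν).same_f

/-- The side ↔ branch dictionary on side A is definitional. -/
theorem D_A_Lval (ν : Ξ) (i : Fin 2) : (N.D ν).A.Lval i = (N.lineA i).L ν := rfl

/-- The side ↔ branch dictionary on side B is definitional. -/
theorem D_B_Lval (ν : Ξ) (i : Fin 2) : (N.D ν).B.Lval i = (N.lineB i).L ν := rfl

/-- Everything but the central values is the base datum's (side A). -/
theorem D_A_periodNonzero (ν : Ξ) : (N.D ν).A.periodNonzero = (N.base ν).A.periodNonzero := rfl

/-- Everything but the central values is the base datum's (side B). -/
theorem D_B_periodNonzero (ν : Ξ) : (N.D ν).B.periodNonzero = (N.base ν).B.periodNonzero := rfl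

/-- The datum at its own twist. -/
def current : N5Data ι G := N.D N.ν

/-- N5 := (ii_A) ∧ (ii_B) for the datum (TIER5 §N5.1). -/
def N5 : Prop := N.current.N5

/-- The datum with its twist replaced. -/
def withTwist (ν' : Ξ) : Datum ι G Ξ ι' K := { N with ν := ν' }

/-- Re-twisting moves the current datum along the family. -/
theorem withTwist_current (ν' : Ξ) : (N.withTwist ν').current = N.D ν' := rfl

/-- N5 for the re-twisted datum is N5 for the member ν′ of the family. -/
theorem withTwist_N5_iff (ν' : Ξ) : (N.withTwist ν').N5 ↔ (N.D ν').N5 := Iff.rfl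

/-- THE FIXED-DATUM FORM OF N5 (TIER5 §N5.1 at the datum's twist): Theorem 5.4's shape on both sides,
Lemma N5.L1 on both sides, (a), (b) and (c) at ν give N5 for the datum — the shape `N5_main`
instantiates, with (c) at ν the one binder Proposition G discharges cofinitely (`exists_good_twist`). -/
theorem N5_of_condC (hT : N.current.A.dichotomy ∧ N.current.B.dichotomy)
    (hL : N.current.A.levelReduction ∧ N.current.B.levelReduction)
    (ha : N.current.A.condA ∧ N.current.B.condA) (hb : N.current.A.condB ∧ N.current.B.condB)
    (hc : N.current.condC) : N.N5 :=
  N5Data.N5_of_residual hT.1 hT.2 hL.1 hL.2 ha.1 ha.2 hb.1 hb.2 hc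

/-- Proposition G for the datum's four branches: a FINITE exceptional set of twists outside which
(c) holds on both sides (route-3 §G (ii), TIER5 §N5.12 (3)). -/
theorem condC_of_notMem (hA : ∀ i, (N.lineA i).Hyps) (hB : ∀ i, (N.lineB i).Hyps) :
    ∃ Z : Set Ξ, Z.Finite ∧ ∀ ν ∉ Z, (N.D ν).condC := by
  let br : Bool × Fin 2 → GBranch ι' Ξ K := fun p => if p.1 then N.lineB p.2 else N.lineA p.2
  have hbr : ∀ p ∈ (Finset.univ : Finset (Bool × Fin 2)), (br p).Hyps := by
    rintro ⟨b, i⟩ -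
    cases b <;> simp only [br] <;> first | exact hA i | exact hB i
  obtain ⟨Z, hZ, hgood⟩ := forall_ne_zero_of_notMem Finset.univ (fun p => (br p).toBranchData)
    fun p hp => GBranch.cofiniteNonvanishing (hbr p hp)
  refine ⟨Z, hZ, fun ν hν => ⟨?_, ?_⟩⟩
  · apply ToricSide.condC_of_ne_zero
    intro i
    rw [D_A_Lval]
    simpa [br] using hgood ν hν (false, i) (Finset.mem_univ _)
  · apply ToricSide.condC_of_ne_zero
    intro i
    rw [D_B_Lval]
    simpa [br] using hgood ν hν (true, i) (Finset.mem_univ _)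

/-- EX for the twist, in kernel: with Ξ_𝔭 infinite and Proposition G's hypotheses on the four
branches, SOME twist makes (c) hold on both sides — the existence of the datum's admissible finite
parts ([G-N5.1], TIER5 §N5.8) as far as ν is concerned. -/
theorem exists_good_twist (hΞ : (Set.univ : Set Ξ).Infinite) (hA : ∀ i, (N.lineA i).Hyps)
    (hB : ∀ i, (N.lineB i).Hyps) : ∃ ν, (N.D ν).condC :=
  exists_condC_of_propG N.D hΞ N.lineA N.lineB hA hB (fun _ _ => rfl) (fun _ _ => rfl)

/-- The family form: Theorem 5.4's shape, N5.L1, (a), (b) for every member of the family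
(§N5.5(g)) and Proposition G's hypotheses give N5 for the datum re-twisted to some good ν. -/
theorem exists_N5 (hΞ : (Set.univ : Set Ξ).Infinite)
    (hT : ∀ ν, (N.D ν).A.dichotomy ∧ (N.D ν).B.dichotomy)
    (hL : ∀ ν, (N.D ν).A.levelReduction ∧ (N.D ν).B.levelReduction)
    (ha : ∀ ν, (N.D ν).A.condA ∧ (N.D ν).B.condA)
    (hb : ∀ ν, (N.D ν).A.condB ∧ (N.D ν).B.condB)
    (hA : ∀ i, (N.lineA i).Hyps) (hB : ∀ i, (N.lineB i).Hyps) :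
    ∃ ν, (N.withTwist ν).N5 :=
  N5_of_propG N.D hΞ hT hL ha hb N.lineA N.lineB hA hB (fun _ _ => rfl) (fun _ _ => rfl)

end Datum

end Summit.Ventures.HodgeRepro2.T6.N5Datum
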